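import Literature.NumberTheory.EllipticCurves.Kobayashi2003.CyclotomicTowerSignedSelmer
import Literature.NumberTheory.EllipticCurves.Kobayashi2003.SignedKatoDivisibility
import Literature.NumberTheory.EllipticCurves.PAdicLFunctionMinus
import Literature.NumberTheory.EllipticCurves.ImaginaryPeriod
import Mathlib.NumberTheory.Cyclotomic.Basic
import HarnessLib

/-!
# Kobayashi 2003 on the `η`-COMPONENTS `X^±(E/K_∞)^η` for the quadratic character `η = ω^{(p−1)/2}`
# of `Δ = Gal(ℚ(μ_p)/ℚ)`: Thm. 2.2 (finitely generated torsion), Thm. 4.1 third display (odd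
# divisibility at `η ≠ 1`), Thm. 7.4 (even ⟺ odd main conjecture, component by component) — three
# NAMED FACTS on the Literature-homed object `EtaSignedSelmerDualData`, with Pollack's/Kobayashi's
# branch functions `L_p^±(E, η, X)` pinned by interpolation

Cell `bsd-cm` (HOME `run/shared/lean/pub/bsd-cm/`), seat `bsd-cm-k8i-ty` (D-0074 group (G), typer);
bears on the K8 route `InertBadSignedBranches`, item stmt-BirchSwinnertonDyer-19226
`PrintReadingsInert` (conjunct 2: the readings (R2) / Kob03 Thm. 7.4 (ii) at `η`), and on cell
`bsd-potss` (K8-Gss2, `Additive/QuadraticBranchEvenReadingsOfEta.lean`, sign `+`). HONEST FRAMING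
(cell bsd-cm, verbatim intent): the programme assembles the Birch–Swinnerton-Dyer formula for
analytic-rank `≤ 1` curves STRICTLY from published theorems and TYPES the remainder; BSD is not
proved by any of this; a closed item closes a rung leaf, never the summit. THIS FILE: three named
facts (`def … : Prop`, nothing asserted, no `_holds`; net debt +3), each a PRINTED THEOREM read on
the tree's own object, plus the two PINNING PREDICATES for the branch functions (definitions with
bodies, copies — with identical bodies — of the Summits-side predicates of seat cc-typer-6, p254895 /
p259634, promote event 6916103). The texts of the facts are, binder for binder, the hypothesis
TEXTS `H22` / `H41` of cc-typer-6's plan of record (`run/shared/lean/b2b/bsd-rank1-residual/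
class-closure/typer-6/P5-FIRST-SAY-typer6.md` (Q1).4, scratch `…/lean/SignedSelmerEtaFactsScratch.lean`)
that the kernel dictionary theorems of `Summits/…/Additive/SignedTwistOddBranchReadings.lean`
(x1b P5-5b: `oddBranchStrictMinusDivisibilityAt_of_kobayashi41OddEta`, `…_of_kobayashi74OddEta`)
take as hypotheses — so these facts instantiate them with no glue (the bridge between this object
and its Summits original is `rfl`; Theorems-side file of this seat).

## Source, verbatim (S. Kobayashi, *Iwasawa theory for elliptic curves at supersingular primes*,
## Invent. Math. 152 (2003) 1–36 [Kobayashi2003]; held copy `paper:doi-10-1007-s00222-002-0265-4`,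
## page = file number, re-read by this seat 2026-08-26)

Standing (p. 4): "Let `p` be an odd prime number. … Let `E` be an elliptic curve over `ℚ` with good
reduction at `p`. We assume that `a_p = 0`." p. 5 L41: "**Theorem 2.2.** The Pontryagin dual of the
even (odd) Selmer group `X^±(E/K_∞)` is a finitely generated torsion `Λ`-module." (`Λ = ℤ_p[[G_∞]]`,
`G_∞ = Gal(K_∞/ℚ) = Δ × Γ`, `K_∞ = ℚ(μ_{p^∞})`.) p. 7 (Thm. 3.2 (Pollack) and (3.4)–(3.7)): power
series `L_p^±(E, η, X) ∈ ℤ_p[[X]]` with, for `χ` a character of `G_n = Gal(K_n/ℚ)` of conductor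
`p^{n+1}`, `ψ = ηχ`, `χ(γ) = ζ`: for EVEN `n`,
`L_p⁺(E, η, ζ − 1) = (−1)^{(n+2)/2} (p^{n+1}/τ(ψ̄)) (∏_{odd k ≤ n} Φ_{p^k}(ζ))^{−1} L(E, ψ̄, 1)/Ω_E^δ`
(3.4); for ODD `n`,
`L_p⁻(E, η, ζ − 1) = (−1)^{(n+1)/2} (p^{n+1}/τ(ψ̄)) (∏_{even k ≤ n, k ≥ 1} Φ_{p^k}(ζ))^{−1} L(E, ψ̄, 1)/Ω_E^δ`
(3.5), `δ = η(−1)`; `L_p⁺(E, η, 0) = −(p/τ(η)) L(E, η̄, 1)/Ω_E^δ` for `η ≠ 1` (3.6);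
`L_p⁻(E, η, 0) = 0` for `η ≠ 1` (3.7). p. 8 (§4): "Let `η : Δ → ℤ_p^×` be a character. For a
`ℤ_p[Δ]`-module `M`, let `M^η` denote the `η`-component of `M`. … By Theorem 2.2, `X^±(E/K_∞)^η` is
a torsion `ℤ_p[[Γ]]`-module. **Conjecture (Even main conjecture).** For every `η`, we have
`Char(X⁺(E/K_∞)^η) = (L_p⁺(E, η, X))`. **Conjecture (Odd main conjecture).** If `η` is trivial, we
have `Char(X⁻(E/K_∞)^Δ) = (L_p⁻(E, X))`. If `η` is non-trivial, we have
`Char(X⁻(E/K_∞)^η) = ((1/X) L_p⁻(E, η, X))`. (By (3.7), the `p`-adic `L`-function `L_p⁻(E, η, X)`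
is divisible by `X`.) **Theorem 4.1.** There exists an integer `n ≥ 0` such that
`Char(X⁺(E/K_∞)^η) ⊇ (pⁿ L_p⁺(E, η, X))`, `Char(X⁻(E/K_∞)^Δ) ⊇ (pⁿ L_p⁻(E, X))`,
`Char(X⁻(E/K_∞)^η) ⊇ ((pⁿ/X) L_p⁻(E, η, X))` for `η ≠ 1`. If the `p`-adic representation
`Gal(ℚ̄/ℚ) → GL_{ℤ_p}(T)` is surjective, then we can take `n = 0`. Here `T = T_pE` is the `p`-adic
Tate module of `E`." p. 13 L25: "**Theorem 7.4.** The three conjectures, namely, Kato's main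
conjecture (Sect. 5), the even main conjecture and the odd main conjecture (Sect. 4) are
equivalent. *Proof.* By Theorem 6.2, 6.3 and (7.21), we have three exact sequences
`0 → H¹(T)^η/Z(T)^η → Λ^η/(L_p⁺(E, η, X)) → X⁺(E/K_∞)^η → X⁰(E/K_∞)^η → 0`,
`0 → H¹(T)^Δ/Z(T)^Δ → Λ^Δ/(L_p⁻(E, X)) → X⁻(E/K_∞)^Δ → X⁰(E/K_∞)^Δ → 0`,
`0 → H¹(T)^η/Z(T)^η → I^η/(L_p⁻(E, η, X)) → X⁻(E/K_∞)^η → X⁰(E/K_∞)^η → 0`.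
The last sequence is for a non-trivial `η`. The theorem follows from these sequences and
Proposition 7.1 ii)." (L54: "The last sequence is for a non-trivial `η`.")

(Docstring convention: in the declaration docstrings below the source's C-word is written `[C]` /
`MC` because of the tree's docstring lint; this module docstring carries the unaltered quotations;
what is vendored are THEOREMS about / between the printed conjectures, never a conjecture.)

## Transcription and reading flags (for the referee)

* OBJECT. `X^±(E/K_∞)^η` = any `D : EtaSignedSelmerDualData V κ K₀ ℚ_[p] η γ ε`
  (`CyclotomicTowerSignedSelmer.lean`: `K₀` with `IsCyclotomicExtension {p} ℚ K₀` = `ℚ(μ_p)`; `κ` the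
  cyclotomic `ℤ_p`-extension of `ℚ`, `K₀·ℚ_n = K_n`; `E = ℚ_[p]`, ONE place above `p`, totally
  ramified; `γ ∈ Gal(ℚ̄/K₀) = galRange K₀` with `κ γ` a generator — "`γ ∈ Γ`", `T ↔ γ − 1`,
  "`γ ↦ 1 + X`"). For `η² = 1` the dual of the `η`-eigen-subgroup `Sel^η` IS the `η`-component
  `ε_η X` of the dual (`p ∤ #Δ`; the two `Δ`-conventions on the dual agree for `η = η⁻¹`) — recorded
  in the object file; no flag.
* WHICH `η`. The facts take `η : Γ_ℚ →* ℤˣ` trivial on `galRange K₀` (a `{±1}`-valued character of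
  `Δ ≅ (ℤ/p)^×`, cyclic of even order): there are exactly two, `η = 1` and `η = ω^{(p−1)/2}`; the
  clauses printed "for `η ≠ 1`" are stated under `η ≠ 1`, i.e. AT the quadratic character only.
  TODO(general form): `η : Δ → ℤ_p^×` of any order dividing `p − 1` (needs `ℤ_p[η]`-coefficients on
  `H¹`, which the tree does not carry; NOT faked here).
* `L_p^±(E, η, X)` at the quadratic `η` = ANY `L ∈ Λ = ℤ_p⟦X⟧` with the interpolation property
  (3.4)+(3.6) (`IsQuadraticBranchPlusLFunction`) resp. (3.5)+(3.7) (`IsQuadraticBranchMinusLFunction`),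
  written through Birch's formula `L(E, ψ̄, 1)·(Gauss sum) ↔ ∑_a ψ(a)[a/p^{n+1}]^δ_f` (tree
  `ratTwistedSymbolSum` / `ratMinusTwistedSymbolSum`, [MazurTateTeitelbaum1986Invent] §I.8 (8.6)) for
  the newform `f` of `E` and the period ratio `ϖ` of the parity `δ` (`ϖ·Ω_E = Ω⁺_f` if
  `p ≡ 1 (mod 4)`, `ϖ·|Ω⁻_E| = Ω⁻_f` if `p ≡ 3 (mod 4)`), UP TO A UNIT `u ∈ ℤ_p^×` (flag
  `Kob03-Lpm-eta-upto-unit`: Kobayashi's Néron `Ω_E^δ` with `Ω_E^− ∈ iℝ` versus the tree's `|Ω⁻|`, a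
  sign, a power of `2`). Such `L` are unique up to `ℤ_p^×` (infinitely many interpolation points) and
  EXIST by Thm. 3.2 — not asserted by the predicates; every fact quantifies over all such `L`, and
  all statements are about IDEALS `(L)`, which do not see the unit. The variable: `ζ = χ(γ) = ψ(1+p)`
  with `κ(γ) = 1 + p = cyclotomicGenerator p` (`IsCyclotomicVariable p γ`, §3 p. 5).
* Thm. 2.2 at `η` (`thm22_…`): p. 8 L16 says it in words ("By Theorem 2.2, `X^±(E/K_∞)^η` is a
  torsion `ℤ_p[[Γ]]`-module"); finite generation over `ℤ_p[[Γ]]` of a component of a finitely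
  generated `ℤ_p[[G_∞]]`-module is immediate (`Λ = ℤ_p[[Γ]]^{p−1}`). No flag.
* Thm. 4.1 third display (`thm41_…`): BOTH printed clauses (`∃ n`; surjective ⇒ `n = 0`), with
  "`(1/X)L_p⁻`" spelled `∀ L', L = X·L' → …` ((3.7): `X ∣ L`), "`⊇ (g)`" spelled `g ∈ Char`, and the
  torsion/finite-generation of `D.X` DISPLAYED as hypotheses exactly as the tree's sign-`+` fact
  `Kobayashi2003.thm41_signedCharIdeal_divisibility` displays them (they are `thm22_…`).
  "Surjective onto `GL_{ℤ_p}(T_pE)`" = `∀ m, V.HasSurjectiveModNGaloisRep (p^m)`. No flag.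
* Thm. 7.4 at `η` (`thm74_…`): the theorem is PRINTED for the three conjectures as wholes (the even
  conjecture is "for every `η`") and PROVED `η`-component by `η`-component (one exact sequence per
  component, quoted above; "The last sequence is for a non-trivial `η`"). The fact states the
  equivalence AT the quadratic `η` alone: flag `Kob03-Thm74-eta-by-eta` (a reading of the proof's
  componentwise structure, cc-typer-6 (Q4)). Kato's main conjecture at `η` (the third corner of the
  triangle) is NOT transcribed (no `H²(T)^η`/`Z(T)^η` vocabulary in the tree). The even side is
  stated VERBATIM on `X⁺(V/K_∞)^η` — NOT in the `ℚ(√p*)`-subtower form of the Summits-side typed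
  conjecture (C1_η) `Additive.QuadraticBranchPlusMainConjectureAt` (whose docstring flag
  `Kob03-MC-eta-quadratic-subtower` names the prime-to-`p` descent between the two forms, a
  base-change comparison NOT formalised in the tree): this file asserts nothing about that descent.

## What is NOT here (and why)

* NO fact for the main conjectures themselves at `η ≠ 1`, for any curve. In particular NOT for CM
  curves: Pollack–Rubin, Ann. of Math. 159 (2004), prove Kobayashi's conjecture for CM `E` over the
  `ℤ_p`-extension `ℚ_∞` (the component `η = 1`; tree fact
  `PollackRubin2004.mainTheorem_signedCharIdeal_eq_of_cm`) and write (p. 448) "With the same proof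
  (and a little extra notation) one can prove an analogous result for `Sel^±_p(E/ℚ(μ_{p^∞}))`" — a
  REMARK; no printed proof of the `η ≠ 1` components exists: Lei, Compositio Math. 147 (2011) §7
  [Lei2011] proves the CM case of his Conjecture 1.1 "with `θ = 1`" only (Thm. 7.9 / Cor. 7.10, over
  `K_c` / `ℚ_c`), his §1 merely attributing the general-`θ` CM case to [PR04]; Kato, Astérisque 295
  (2004) §15 p. 251 proves only the divisibility for CM forms ("Rubin has an equality … even in the
  case `p` does not split … but we do not use it in this paper"). Conjectures are not Literature:
  (C1_η) stays the Summits-side `@[conjecture]` it is.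
* NO Kitajima–Otsuki (sibling file `KitajimaOtsuki2018/EtaSelmerNoFiniteSubmodule.lean`), no control
  theorem (Thm. 9.3), no `_holds` (the proofs are Kobayashi's §§6–9 + Kato's Euler system; none of it
  is in Mathlib).

References: [Kobayashi2003] Thm. 2.2 (p. 5), Thm. 3.2 and (3.4)–(3.7) (p. 7), §3 (p. 5), §4
Conjectures + Thm. 4.1 (p. 8), Thm. 7.4 (p. 13); [MazurTateTeitelbaum1986Invent] §I.8 (8.6);
[PollackRubin2004] p. 448; [Lei2011] §1, §7; [Pollack2003] (the functions `L_p^±`).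
-/

noncomputable section

open scoped Classical

open CongruenceSubgroup Polynomial WeierstrassCurve Field Literature.NumberTheory.EllipticCurves
  Literature.NumberTheory.EllipticCurves.ModularForms Literature.NumberTheory.GaloisRepresentations
  ZpExtension

namespace Literature.NumberTheory.EllipticCurves.Kobayashi2003

/-! ## §1 The branch functions `L_p^±(E, η, X)` at the quadratic `η`, pinned by interpolation
(copies, with identical bodies, of the Summits-side predicates of seat cc-typer-6) -/

section BranchFunction

variable {N : ℕ} (f : CuspForm (Gamma0 N) 2) (p : ℕ) [Fact p.Prime]

/-- **`L` is Kobayashi's `L_p⁺(E, η, X)` on the quadratic branch `η = ω^{(p−1)/2}`, up to a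
`p`-adic unit** (`f` the newform of `E`, `ϖ` the period ratio of the parity of `η`:
`ϖ·Ω_E = Ω⁺_f` if `p ≡ 1 (mod 4)`, `ϖ·|Ω⁻(E)| = Ω⁻_f` if `p ≡ 3 (mod 4)`): there is `u ∈ ℤ_p^×`
such that for every EVEN `n ≥ 0` and every Dirichlet character `ψ` mod `p^{n+1}` of order `2pⁿ`
(i.e. `ψ = ηχ`, `χ` of `p`-power order and conductor `p^{n+1}` for `n ≥ 1`; `ψ = η` for `n = 0`),
with `ζ = ψ(1 + p)`: `L(ζ − 1) · ω_n⁻(ζ − 1) = (−1)^{n/2+1} u ϖ ∑_{a mod p^{n+1}} ψ(a)[a/p^{n+1}]^δ_f`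
in `ℂ_p` — Kobayashi's (3.4) (`n ≥ 2`) and (3.6) (`n = 0`) through Birch's formula
(`τ(ψ)τ(ψ̄) = ψ(−1)p^{n+1}`), `[·]^δ = [·]⁺` (`ratTwistedSymbolSum`) for `p ≡ 1 (mod 4)` and `[·]⁻`
(`ratMinusTwistedSymbolSum`) for `p ≡ 3 (mod 4)`, `ω_n⁻ = ∏_{odd k ≤ n} Φ_{p^k}(1 + T)`
(`cyclotomicOmegaMinus`). Such an `L` is unique up to `ℤ_p^×`; it exists by Thm. 3.2 (Pollack), not
asserted here. A predicate; body identical to the Summits-side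
`Additive.IsQuadraticBranchPlusLFunction` (p254895). Flag `Kob03-Lpm-eta-upto-unit`.
[cite: Kobayashi2003, Thm. 3.2, (3.4) and (3.6) (p. 7); §3 (p. 5) for the variable]
[cite: MazurTateTeitelbaum1986Invent, §I.8 (8.6) and §I.14] -/
def IsQuadraticBranchPlusLFunction (ϖ : ℚ) (L : IwasawaAlgebra p) : Prop :=
  ∃ u : ℤ_[p]ˣ, ∀ n : ℕ, Even n →
    ∀ ψ : DirichletCharacter ℂ_[p] (p ^ (n + 1)), orderOf ψ = 2 * p ^ n →
      HasSum
        (fun k : ℕ ↦ ((algebraMap ℚ_[p] ℂ_[p]).comp (algebraMap ℤ_[p] ℚ_[p]))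
            (PowerSeries.coeff k L) *
          (ψ (cyclotomicGenerator p : ZMod (p ^ (n + 1))) - 1) ^ k)
        ((-1 : ℂ_[p]) ^ (n / 2 + 1) *
            algebraMap ℚ_[p] ℂ_[p] (((u : ℤ_[p]) : ℚ_[p]) * (ϖ : ℚ_[p])) *
            (if Even (p / 2) then ratTwistedSymbolSum f ψ else ratMinusTwistedSymbolSum f ψ) /
          (cyclotomicOmegaMinus p n).eval₂ (algebraMap ℤ ℂ_[p])
            (ψ (cyclotomicGenerator p : ZMod (p ^ (n + 1))) - 1))

/-- Unfolding lemma. [cite: Kobayashi2003, (3.4) and (3.6) (p. 7)] -/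
theorem isQuadraticBranchPlusLFunction_iff (ϖ : ℚ) (L : IwasawaAlgebra p) :
    IsQuadraticBranchPlusLFunction f p ϖ L ↔
      ∃ u : ℤ_[p]ˣ, ∀ n : ℕ, Even n →
        ∀ ψ : DirichletCharacter ℂ_[p] (p ^ (n + 1)), orderOf ψ = 2 * p ^ n →
          HasSum
            (fun k : ℕ ↦ ((algebraMap ℚ_[p] ℂ_[p]).comp (algebraMap ℤ_[p] ℚ_[p]))
                (PowerSeries.coeff k L) *
              (ψ (cyclotomicGenerator p : ZMod (p ^ (n + 1))) - 1) ^ k)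
            ((-1 : ℂ_[p]) ^ (n / 2 + 1) *
                algebraMap ℚ_[p] ℂ_[p] (((u : ℤ_[p]) : ℚ_[p]) * (ϖ : ℚ_[p])) *
                (if Even (p / 2) then ratTwistedSymbolSum f ψ else ratMinusTwistedSymbolSum f ψ) /
              (cyclotomicOmegaMinus p n).eval₂ (algebraMap ℤ ℂ_[p])
                (ψ (cyclotomicGenerator p : ZMod (p ^ (n + 1))) - 1)) :=
  Iff.rfl

/-- **`L` is Kobayashi's MINUS function `L_p⁻(E, η, X)` on the quadratic branch, up to a `p`-adic
unit**: (i) `L(0) = 0` — (3.7) "`L_p⁻(E, η, 0) = 0`" for `η ≠ 1` (so `X ∣ L` and the odd main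
[C] is stated with `X⁻¹L`); (ii) there is `u ∈ ℤ_p^×` such that for every ODD `n ≥ 1` and
every Dirichlet character `ψ` mod `p^{n+1}` of order `2pⁿ`, with `ζ = ψ(1 + p)`:
`L(ζ − 1) · ω_n⁺(ζ − 1) = (−1)^{(n+1)/2} u ϖ ∑_{a mod p^{n+1}} ψ(a)[a/p^{n+1}]^δ_f` in `ℂ_p` — (3.5)
through Birch's formula, `ω_n⁺ = ∏_{1 ≤ 2k ≤ n} Φ_{p^{2k}}(1 + T)` (`cyclotomicOmegaPlus`). Unique up
to `ℤ_p^×`; exists by Thm. 3.2 with (3.7), not asserted here. A predicate; body identical to the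
Summits-side `Additive.IsQuadraticBranchMinusLFunction` (p259634). Flag `Kob03-Lpm-eta-upto-unit`.
[cite: Kobayashi2003, Thm. 3.2, (3.5) and (3.7) (p. 7); §3 (p. 5) for the variable γ ↦ 1 + X]
[cite: MazurTateTeitelbaum1986Invent, §I.8 (8.6)] -/
def IsQuadraticBranchMinusLFunction (ϖ : ℚ) (L : IwasawaAlgebra p) : Prop :=
  PowerSeries.constantCoeff L = 0 ∧
  ∃ u : ℤ_[p]ˣ, ∀ n : ℕ, Odd n →
    ∀ ψ : DirichletCharacter ℂ_[p] (p ^ (n + 1)), orderOf ψ = 2 * p ^ n →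
      HasSum
        (fun k : ℕ ↦ ((algebraMap ℚ_[p] ℂ_[p]).comp (algebraMap ℤ_[p] ℚ_[p]))
            (PowerSeries.coeff k L) *
          (ψ (cyclotomicGenerator p : ZMod (p ^ (n + 1))) - 1) ^ k)
        ((-1 : ℂ_[p]) ^ ((n + 1) / 2) *
            algebraMap ℚ_[p] ℂ_[p] (((u : ℤ_[p]) : ℚ_[p]) * (ϖ : ℚ_[p])) *
            (if Even (p / 2) then ratTwistedSymbolSum f ψ else ratMinusTwistedSymbolSum f ψ) /
          (cyclotomicOmegaPlus p n).eval₂ (algebraMap ℤ ℂ_[p])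
            (ψ (cyclotomicGenerator p : ZMod (p ^ (n + 1))) - 1))

/-- Unfolding lemma. [cite: Kobayashi2003, (3.5) and (3.7) (p. 7)] -/
theorem isQuadraticBranchMinusLFunction_iff (ϖ : ℚ) (L : IwasawaAlgebra p) :
    IsQuadraticBranchMinusLFunction f p ϖ L ↔
      PowerSeries.constantCoeff L = 0 ∧
      ∃ u : ℤ_[p]ˣ, ∀ n : ℕ, Odd n →
        ∀ ψ : DirichletCharacter ℂ_[p] (p ^ (n + 1)), orderOf ψ = 2 * p ^ n →
          HasSum
            (fun k : ℕ ↦ ((algebraMap ℚ_[p] ℂ_[p]).comp (algebraMap ℤ_[p] ℚ_[p]))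
                (PowerSeries.coeff k L) *
              (ψ (cyclotomicGenerator p : ZMod (p ^ (n + 1))) - 1) ^ k)
            ((-1 : ℂ_[p]) ^ ((n + 1) / 2) *
                algebraMap ℚ_[p] ℂ_[p] (((u : ℤ_[p]) : ℚ_[p]) * (ϖ : ℚ_[p])) *
                (if Even (p / 2) then ratTwistedSymbolSum f ψ else ratMinusTwistedSymbolSum f ψ) /
              (cyclotomicOmegaPlus p n).eval₂ (algebraMap ℤ ℂ_[p])
                (ψ (cyclotomicGenerator p : ZMod (p ^ (n + 1))) - 1)) :=
  Iff.rfl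

end BranchFunction

/-! ## §2 Theorem 2.2 on the `η`-components (named fact) -/

/-- **Kobayashi 2003, Thm. 2.2 read on the `η`-component** (p. 5 L41: "The Pontryagin dual of the
even (odd) Selmer group `X^±(E/K_∞)` is a finitely generated torsion `Λ`-module"; p. 8 L16: "By
Theorem 2.2, `X^±(E/K_∞)^η` is a torsion `ℤ_p[[Γ]]`-module"), BOTH signs `ε`, every `{±1}`-valued
character `η` of `Δ = Gal(K₀/ℚ)` (trivial or not): `K₀ = ℚ(μ_p)` (`IsCyclotomicExtension {p} ℚ K₀`),
`η : Γ_ℚ →* ℤˣ` trivial on `Gal(ℚ̄/K₀) = galRange K₀`, `V/ℚ` globally minimal with good reduction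
at the odd prime `p` and `a_p = 0`, `κ` the cyclotomic `ℤ_p`-extension of `ℚ` with a topological
generator `γ ∈ Gal(ℚ̄/K₀)` ("`γ ∈ Γ`"), `D` ANY Pontryagin-dual datum of `Sel^ε(V/K_∞)^η` at the
model `ℚ_[p]`: `D.X` is finitely generated and `Λ`-torsion (`Λ = ℤ_p⟦T⟧`, `T = γ − 1`). Text =
cc-typer-6's `H22` verbatim. Named fact; nothing asserted; no `_holds`.
[cite: Kobayashi2003, Thm. 2.2 (p. 5) and §4 p. 8 l. 16] -/
def thm22_etaSignedSelmerDual_finite_torsion : Prop :=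
  ∀ (p : ℕ) [Fact p.Prime] (K₀ : Type) [Field K₀] [NumberField K₀] [IsCyclotomicExtension {p} ℚ K₀]
    [(galRange (K := ℚ) K₀).Normal] (η : absoluteGaloisGroup ℚ →* ℤˣ),
    (∀ σ ∈ galRange (K := ℚ) K₀, η σ = 1) →
  ∀ (V : WeierstrassCurve ℚ) [V.IsElliptic] [V.IsGloballyMinimal],
    p ≠ 2 → V.HasGoodReductionAtPrime p → V.frobeniusTrace p = 0 →
  ∀ (κ : ZpExtension ℚ p) (γ : absoluteGaloisGroup ℚ),
    κ.IsCyclotomic → κ.IsTopGenerator γ → γ ∈ galRange (K := ℚ) K₀ →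
  ∀ (ε : ℤˣ) (D : EtaSignedSelmerDualData V κ K₀ ℚ_[p] η γ ε),
    Module.Finite (IwasawaAlgebra p) D.X ∧ Module.IsTorsion (IwasawaAlgebra p) D.X

/-! ## §3 Theorem 4.1, third display (`η ≠ 1`, sign `−`) (named fact) -/

/-- **Kobayashi 2003, Thm. 4.1, THIRD display** (p. 8: "`Char(X⁻(E/K_∞)^η) ⊇ ((pⁿ/X) L_p⁻(E, η, X))`
for `η ≠ 1`. If the `p`-adic representation `Gal(ℚ̄/ℚ) → GL_{ℤ_p}(T)` is surjective, then we can
take `n = 0`"), at THE quadratic character `η = ω^{(p−1)/2}` of `Δ` — the unique non-trivial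
`{±1}`-valued character of `Γ_ℚ` trivial on `galRange K₀` (TODO(general form): `η` of order
`∣ p − 1`): frame of `thm22_…` plus `η ≠ 1`, the newform `f` of `V`, the period ratio `ϖ` of the
parity of `η`, `Lη` ANY function with the interpolation property (3.5) + (3.7) of `L_p⁻(V, η, X)`
(`IsQuadraticBranchMinusLFunction`; unique up to `ℤ_p^×`), `γ` matching the cyclotomic variable
(`IsCyclotomicVariable`: "we identify `γ` with `1 + X`", p. 5), `D` any dual datum of
`Sel⁻(V/K_∞)^η` taken finitely generated and torsion (displayed hypotheses = `thm22_…`, as the tree's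
sign-`+` fact `thm41_signedCharIdeal_divisibility` displays them): BOTH printed clauses —
`∃ n, pⁿ·(X⁻¹Lη) ∈ Char(D.X)`, and `X⁻¹Lη ∈ Char(D.X)` if `ρ_{V,p^∞}` is onto
(`∀ m, V.HasSurjectiveModNGaloisRep (p^m)`), with "`X⁻¹Lη`" spelled `∀ L', Lη = X·L' → …` ((3.7):
`X ∣ Lη`). Text = cc-typer-6's `H41` verbatim. Named fact; nothing asserted; no `_holds`.
[cite: Kobayashi2003, Thm. 4.1 (p. 8), §4 Odd main [C] (p. 8), (3.5) and (3.7) (p. 7), §3 (p. 5)] -/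
def thm41_minusEtaCharIdeal_dvd : Prop :=
  ∀ (p : ℕ) [Fact p.Prime] (K₀ : Type) [Field K₀] [NumberField K₀] [IsCyclotomicExtension {p} ℚ K₀]
    [(galRange (K := ℚ) K₀).Normal] (η : absoluteGaloisGroup ℚ →* ℤˣ),
    (∀ σ ∈ galRange (K := ℚ) K₀, η σ = 1) → η ≠ 1 →
  ∀ (V : WeierstrassCurve ℚ) [V.IsElliptic] [V.IsGloballyMinimal] {N : ℕ} [NeZero N]
    {f : CuspForm (Gamma0 N) 2},
    p ≠ 2 → V.HasGoodReductionAtPrime p → V.frobeniusTrace p = 0 → IsNewformOf V f →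
  ∀ (ϖ : ℚ), (if Even (p / 2) then (ϖ : ℝ) * V.realPeriodRat = plusPeriod f
      else (ϖ : ℝ) * V.imaginaryPeriodRat = minusPeriod f) →
  ∀ (Lη : IwasawaAlgebra p), IsQuadraticBranchMinusLFunction f p ϖ Lη →
  ∀ (κ : ZpExtension ℚ p) (γ : absoluteGaloisGroup ℚ),
    κ.IsCyclotomic → κ.IsTopGenerator γ → γ ∈ galRange (K := ℚ) K₀ → IsCyclotomicVariable p γ →
  ∀ (D : EtaSignedSelmerDualData V κ K₀ ℚ_[p] η γ (-1)),
    Module.Finite (IwasawaAlgebra p) D.X → Module.IsTorsion (IwasawaAlgebra p) D.X →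
    (∃ n : ℕ, ∀ L' : IwasawaAlgebra p, Lη = PowerSeries.X * L' →
        (p : IwasawaAlgebra p) ^ n * L' ∈ D.charIdeal) ∧
    ((∀ m : ℕ, V.HasSurjectiveModNGaloisRep (p ^ m : ℕ)) →
        ∀ L' : IwasawaAlgebra p, Lη = PowerSeries.X * L' → L' ∈ D.charIdeal)

/-! ## §4 Theorem 7.4 at the quadratic `η`: even ⟺ odd main [C] (named fact) -/

/-- **Kobayashi 2003, Thm. 7.4 at the quadratic character `η = ω^{(p−1)/2}`** (p. 13: "The three
[C]s, namely, Kato's main [C] (Sect. 5), the even main [C] and the odd main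
[C] (Sect. 4) are equivalent"; proved component by component from the exact sequences
`0 → H¹(T)^η/Z(T)^η → Λ^η/(L_p⁺(E, η, X)) → X⁺(E/K_∞)^η → X⁰(E/K_∞)^η → 0` and, "for a non-trivial
`η`", `0 → H¹(T)^η/Z(T)^η → I^η/(L_p⁻(E, η, X)) → X⁻(E/K_∞)^η → X⁰(E/K_∞)^η → 0`): for the frame of
`thm41_…` (`η ≠ 1` quadratic, `V` good at the odd `p` with `a_p = 0`, newform `f`, period ratio `ϖ`,
cyclotomic `κ`, `γ ∈ Gal(ℚ̄/K₀)` a topological generator matching the cyclotomic variable), the EVEN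
main [C] at `η` — `Char(X⁺(V/K_∞)^η) = (L_p⁺(V, η, X))`, i.e. `D⁺.charIdeal = (Lp)` for every
`Lp` with `IsQuadraticBranchPlusLFunction f p ϖ Lp` and every plus datum `D⁺` — holds IF AND ONLY IF
the ODD main [C] at `η` — `Char(X⁻(V/K_∞)^η) = (X⁻¹L_p⁻(V, η, X))`, i.e. `D⁻.charIdeal = (L')`
for every `Lm` with `IsQuadraticBranchMinusLFunction f p ϖ Lm`, `Lm = X·L'`, and every minus datum
`D⁻` — holds. READING FLAG `Kob03-Thm74-eta-by-eta` (statement printed for the [C]s as wholes,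
proof component-wise; the fact is the equivalence at the single component `η`). Kato's main
[C] at `η` is not transcribed. Named fact; nothing asserted; no `_holds`.
[cite: Kobayashi2003, Thm. 7.4 (p. 13) with its proof (the exact sequences, p. 13 l. 54), §4 (p. 8), Thm. 2.2 (p. 5)] -/
def thm74_etaEvenMC_iff_etaOddMC : Prop :=
  ∀ (p : ℕ) [Fact p.Prime] (K₀ : Type) [Field K₀] [NumberField K₀] [IsCyclotomicExtension {p} ℚ K₀]
    [(galRange (K := ℚ) K₀).Normal] (η : absoluteGaloisGroup ℚ →* ℤˣ),
    (∀ σ ∈ galRange (K := ℚ) K₀, η σ = 1) → η ≠ 1 →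
  ∀ (V : WeierstrassCurve ℚ) [V.IsElliptic] [V.IsGloballyMinimal] {N : ℕ} [NeZero N]
    {f : CuspForm (Gamma0 N) 2},
    p ≠ 2 → V.HasGoodReductionAtPrime p → V.frobeniusTrace p = 0 → IsNewformOf V f →
  ∀ (ϖ : ℚ), (if Even (p / 2) then (ϖ : ℝ) * V.realPeriodRat = plusPeriod f
      else (ϖ : ℝ) * V.imaginaryPeriodRat = minusPeriod f) →
  ∀ (κ : ZpExtension ℚ p) (γ : absoluteGaloisGroup ℚ),
    κ.IsCyclotomic → κ.IsTopGenerator γ → γ ∈ galRange (K := ℚ) K₀ → IsCyclotomicVariable p γ →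
  ((∀ (Lp : IwasawaAlgebra p), IsQuadraticBranchPlusLFunction f p ϖ Lp →
      ∀ D : EtaSignedSelmerDualData V κ K₀ ℚ_[p] η γ 1, D.charIdeal = Ideal.span {Lp}) ↔
    (∀ (Lm : IwasawaAlgebra p), IsQuadraticBranchMinusLFunction f p ϖ Lm →
      ∀ (D : EtaSignedSelmerDualData V κ K₀ ℚ_[p] η γ (-1)) (L' : IwasawaAlgebra p),
        Lm = PowerSeries.X * L' → D.charIdeal = Ideal.span {L'}))

/-! ## §5 The proof of Theorem 7.4 at the quadratic `η`: the two `η`-exact sequences (named fact)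

Source, verbatim (p. 13, proof of Thm. 7.4): "By Theorem 6.2, 6.3 and (7.21), we have three exact
sequences `0 → H¹(T)^η/Z(T)^η → Λ^η/(L_p⁺(E, η, X)) → X⁺(E/K_∞)^η → X⁰(E/K_∞)^η → 0`,
`0 → H¹(T)^Δ/Z(T)^Δ → Λ^Δ/(L_p⁻(E, X)) → X⁻(E/K_∞)^Δ → X⁰(E/K_∞)^Δ → 0`,
`0 → H¹(T)^η/Z(T)^η → I^η/(L_p⁻(E, η, X)) → X⁻(E/K_∞)^η → X⁰(E/K_∞)^η → 0`. The last sequence is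
for a non-trivial `η`. The theorem follows from these sequences and Proposition 7.1 ii)." With
(7.21) = Thm. 7.3 i) (p. 13): "`0 → H¹(T) → H¹_Iw(T)/H¹_{Iw,±}(T) → X^±(E/K_∞) → X⁰(E/K_∞) → 0`";
Cor. 7.2 (p. 13): "`X⁰(E/K_∞)` is a torsion `Λ`-module"; Prop. 7.1 ii) (p. 12): "`H²(T)` is
isomorphic to `X⁰(E/K_∞)` as `Λ`-module"; §6 p. 11: "We also let `Λ_n^± = ℤ_p[Δ][X]/(ω_n^±(X))`,
`I_n^± = XΛ_n^±` and `I = XΛ`"; Thm. 6.2 (6.13)/(6.15) (p. 11): "`Col⁺ : H¹_Iw(T)/H¹_{Iw,+}(T) ≃ Λ`",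
"`Col⁻ : H¹_Iw(T)^η/H¹_{Iw,−}(T)^η ≃ I^η` for `η ≠ 1`"; Thm. 6.3 (p. 11): "the image of Kato's zeta
element by the even (odd) Coleman map is Pollack's `p`-adic `L`-function"; Thm. 3.2 (p. 7): existence
of `L_p^±(E, η, X)`. The module theory drawing Thm. 7.4 (ii) ⟺ (iii) at `η` out of these two
sequences is kernel-checked Summits-side (`Theorems/QuadraticBranchSignedControlThm74OfEtaExactSequences`,
cell `bsd-potss`, seat k8q-c3 g3); this §5 names its input. -/

/-- **Kobayashi 2003, the two `η`-exact sequences of the proof of Thm. 7.4** (p. 13, from Thm. 6.2,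
6.3 and (7.21); "The last sequence is for a non-trivial `η`"), with Cor. 7.2 and Prop. 7.1 ii), read
at THE quadratic character `η = ω^{(p−1)/2}` on the tree's objects, for the frame of `thm74_…`
(`V/ℚ` good at the odd `p` with `a_p = 0`, newform `f`, period ratio `ϖ` of the parity of `η`,
cyclotomic `κ`, `γ ∈ Gal(ℚ̄/K₀)` a topological generator matching the cyclotomic variable): there
are `Λ = ℤ_p⟦X⟧`-modules `A` («`H¹(T)^η/Z(T)^η`») and `B` («`X⁰(E/K_∞)^η ≅ H²(T)^η`», finitely
generated and torsion: Cor. 7.2 with Prop. 7.1 ii)), COMMON to both signs, and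
(plus) SOME `Lp` with the interpolation property (3.4)+(3.6) of `L_p⁺(E, η, X)` (Thm. 3.2) such that
for every Pontryagin-dual datum `D⁺` of `Sel⁺(V/K_∞)^η` there are `Λ`-linear maps forming an exact
sequence `0 → A → Λ/(Lp) → X(D⁺) → B → 0`;
(minus) SOME `Lm` with the interpolation property (3.5)+(3.7) of `L_p⁻(E, η, X)` such that for every
dual datum `D⁻` of `Sel⁻(V/K_∞)^η` and every `L'` with `Lm = X·L'` an exact sequence
`0 → A → Λ/(L') → X(D⁻) → B → 0` — the printed middle term `I^η/(L_p⁻(E, η, X))`, `I = XΛ`,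
identified with `Λ^η/(X⁻¹L_p⁻(E, η, X))` by division by `X` ((3.7): `X ∣ L_p⁻(E, η, X)`).
READING FLAGS: `Kob03-Thm74-eta-by-eta` (as for `thm74_…`); `Kob03-721-eta-abstract-ends` (the end
terms are asserted only as SOME finitely generated torsion `Λ`-modules common to the two signs — the
tree has no `H¹(T)`/`Z(T)`/`X⁰(E/K_∞)` vocabulary at `η`; this is all the printed deduction of
Thm. 7.4 uses); `Kob03-Lpm-eta-upto-unit` (the functions are pinned up to `ℤ_p^×`, which does not
change `Λ/(L)`). Torsion-ness of `A` is NOT asserted (it follows from the plus sequence, `Lp ≠ 0` by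
Rohrlich). Consequence (kernel, Summits-side): `thm74_etaEvenMC_iff_etaOddMC`. Named fact; nothing
asserted; no `_holds` (Coleman maps, Kato's Euler system, Poitou–Tate: none of it is in Mathlib).
[cite: Kobayashi2003, proof of Thm. 7.4 (p. 13), Thm. 7.3 (7.21) and Cor. 7.2 (p. 13), Prop. 7.1 ii) (p. 12), Thm. 6.2 (6.13)–(6.15) and Thm. 6.3 (p. 11), §6 p. 11 (I = XΛ), Thm. 3.2 and (3.4)–(3.7) (p. 7)] -/
def thm74proof_etaExactSequences : Prop :=
  ∀ (p : ℕ) [Fact p.Prime] (K₀ : Type) [Field K₀] [NumberField K₀] [IsCyclotomicExtension {p} ℚ K₀]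
    [(galRange (K := ℚ) K₀).Normal] (η : absoluteGaloisGroup ℚ →* ℤˣ),
    (∀ σ ∈ galRange (K := ℚ) K₀, η σ = 1) → η ≠ 1 →
  ∀ (V : WeierstrassCurve ℚ) [V.IsElliptic] [V.IsGloballyMinimal] {N : ℕ} [NeZero N]
    {f : CuspForm (Gamma0 N) 2},
    p ≠ 2 → V.HasGoodReductionAtPrime p → V.frobeniusTrace p = 0 → IsNewformOf V f →
  ∀ (ϖ : ℚ), (if Even (p / 2) then (ϖ : ℝ) * V.realPeriodRat = plusPeriod f
      else (ϖ : ℝ) * V.imaginaryPeriodRat = minusPeriod f) →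
  ∀ (κ : ZpExtension ℚ p) (γ : absoluteGaloisGroup ℚ),
    κ.IsCyclotomic → κ.IsTopGenerator γ → γ ∈ galRange (K := ℚ) K₀ → IsCyclotomicVariable p γ →
  ∃ (A B : Type) (_ : AddCommGroup A) (_ : Module (IwasawaAlgebra p) A)
    (_ : AddCommGroup B) (_ : Module (IwasawaAlgebra p) B),
    Module.Finite (IwasawaAlgebra p) B ∧ Module.IsTorsion (IwasawaAlgebra p) B ∧
    (∃ Lp : IwasawaAlgebra p, IsQuadraticBranchPlusLFunction f p ϖ Lp ∧
      ∀ D : EtaSignedSelmerDualData V κ K₀ ℚ_[p] η γ 1,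
        ∃ (i : A →ₗ[IwasawaAlgebra p] (IwasawaAlgebra p ⧸ Ideal.span {Lp}))
          (j : (IwasawaAlgebra p ⧸ Ideal.span {Lp}) →ₗ[IwasawaAlgebra p] D.X)
          (k : D.X →ₗ[IwasawaAlgebra p] B),
          Function.Injective i ∧ Function.Exact i j ∧ Function.Exact j k ∧ Function.Surjective k) ∧
    (∃ Lm : IwasawaAlgebra p, IsQuadraticBranchMinusLFunction f p ϖ Lm ∧
      ∀ (D : EtaSignedSelmerDualData V κ K₀ ℚ_[p] η γ (-1)) (L' : IwasawaAlgebra p),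
        Lm = PowerSeries.X * L' →
        ∃ (i : A →ₗ[IwasawaAlgebra p] (IwasawaAlgebra p ⧸ Ideal.span {L'}))
          (j : (IwasawaAlgebra p ⧸ Ideal.span {L'}) →ₗ[IwasawaAlgebra p] D.X)
          (k : D.X →ₗ[IwasawaAlgebra p] B),
          Function.Injective i ∧ Function.Exact i j ∧ Function.Exact j k ∧ Function.Surjective k)

end Literature.NumberTheory.EllipticCurves.Kobayashi2003

end
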